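import Summits.PneNP.PneNP.Theorems.SzkEntropyPeaWorstToAvg
import Summits.PneNP.PneNP.Theorems.SzkEntropyPeaWorstToAvgDualMode
import Literature.Computability.MetaComplexity.SamplableMixtures

/-!
# PneNP / SzkEntropy — crux `PeaWorstToAvg` (stmt-PneNP-10777): Card B (`dual-mode-compile`),
# first lemma and transfer shape, PROVED

Assembly of the two support files of the crux chain's Card B:

* `Literature/Computability/MetaComplexity/SamplableMixtures.lean` — the fair mixture
  `mixEnsemble K₀ K₁ = ½ K₀ + ½ K₁` of two polynomial-time samplable ensembles is polynomial-time
  samplable (`Ensemble.isPolySamplable_mixEnsemble`) and dominates each component up to the factor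
  `2` (`toOuterMeasure_le_two_mul_mixEnsemble`);
* `SzkEntropyPeaWorstToAvgDualMode.lean` — an indistinguishable promise-separated pair makes
  `((PEA d).yes, D)` `HeurBPP`-hard for every `D` dominating both (`pea_not_mem_HeurBPP_of_dualMode`).

Together they give, literally, the first lemma `conclusion_of_dualMode` of
`Cruxes/PeaWorstToAvg/Sketch.lean` (Card B of crux-ideate round 1) — two polynomial-time samplable
ensembles of `PEA₃` instances, one supported on NO instances and one on YES instances, that are
computationally indistinguishable, give the crux's conclusion with `D` = their fair mixture — and
the card's TRANSFER SHAPE `peaWorstToAvg_of_dualMode_transfer`: the crux `PeaWorstToAvg` follows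
from the one primitive-existence statement "worst-case hardness of `PEA₃` yields an
indistinguishable promise-separated samplable pair of cubic-map ensembles" (a dual-mode / lossy
family from worst-case `SZK_L` hardness — the OPEN part of the card, not claimed here).

References: Z. Dvir, D. Gutfreund, G. Rothblum, S. Vadhan, *On approximating the entropy of
polynomial mappings*, ICS 2011, pp. 2–3; C. Peikert, B. Waters, *Lossy trapdoor functions and their
applications*, STOC 2008; O. Goldreich, *Foundations of Cryptography I* (2001), Def. 3.2.2;
A. Bogdanov, L. Trevisan, *Average-Case Complexity* (2006), Def. 2.1, 2.12–2.13.
-/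

namespace Summit.PneNP.PneNP.Theorems

open Literature.Computability.Complexity Literature.Computability.MetaComplexity
open Literature.Computability.Cryptography (IsCompIndistinguishable IsPPT distAdvantage)
open _root_.Computability

/-- **Infinitely-often indistinguishability suffices.** The hardness mechanism of
`not_mem_HeurBPP_of_isCompIndistinguishable` only needs, for every PPT distinguisher `B`, ONE
parameter `n` at which `B` tells `K₀,ₙ` from `K₁,ₙ` with advantage `< 9/32` (the advantage of the
padded simulator of a heuristic scheme is `≥ 9/32` at every `n`, `le_distAdvantage_of_scheme`); so an
"i.o.-indistinguishable" promise-separated pair (cf. the card's transfer shape) already makes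
`(Q.yes, D)` `HeurBPP`-hard for every `D` dominating both components up to the factor `2`.
[Goldreich2001, Def. 3.2.2; BogdanovTrevisan2006, Def. 2.12–2.13] -/
theorem not_mem_HeurBPP_of_io_indistinguishable {Q : PromiseProblem} (hQ : Q.Disjoint)
    {K₀ K₁ D : Ensemble}
    (h₀ : ∀ n : ℕ, ∀ w ∈ (K₀ n).support, w ∈ Q.no) (h₁ : ∀ n : ℕ, ∀ w ∈ (K₁ n).support, w ∈ Q.yes)
    (hD₀ : ∀ (n : ℕ) (E : Set (List Bool)), (K₀ n).toOuterMeasure E ≤ 2 * (D n).toOuterMeasure E)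
    (hD₁ : ∀ (n : ℕ) (E : Set (List Bool)), (K₁ n).toOuterMeasure E ≤ 2 * (D n).toOuterMeasure E)
    (hio : ∀ B : RandAlg (List Bool) Bool, IsPPT B encodeBool → ∃ n, distAdvantage B K₀ K₁ n < 9 / 32) :
    (⟨Q.yes, D⟩ : DistProblem) ∉ HeurBPP := by
  rintro ⟨A, hA, hbad⟩
  obtain ⟨B, hB, hout⟩ := exists_padded_simulator hA
  obtain ⟨n, hn⟩ := hio B hB
  exact absurd (le_distAdvantage_of_scheme hQ h₀ h₁ hD₀ hD₁ hbad hout n) (not_le.2 hn)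

/-- Computational indistinguishability gives the infinitely-often hypothesis of
`not_mem_HeurBPP_of_io_indistinguishable` (negligible advantage is eventually `< 9/32`).
[Goldreich2001, Def. 3.2.2] -/
theorem exists_distAdvantage_lt_of_isCompIndistinguishable {K₀ K₁ : Ensemble}
    (hind : IsCompIndistinguishable K₀ K₁) (B : RandAlg (List Bool) Bool) (hB : IsPPT B encodeBool) :
    ∃ n, distAdvantage B K₀ K₁ n < 9 / 32 := by
  have hev := (hind B hB 0).eventually (gt_mem_nhds (show (0 : ℝ) < 9 / 32 by norm_num))
  obtain ⟨n, hn⟩ := hev.exists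
  simp only [pow_zero, one_mul] at hn
  exact ⟨n, hn⟩

/-- **The fair mixture of a promise-separated pair is supported on the promise.**
[BogdanovTrevisan2006, Def. 2.1] -/
theorem mixEnsemble_support_subset_promise {Q : PromiseProblem} {K₀ K₁ : Ensemble}
    (h₀ : ∀ n : ℕ, ∀ w ∈ (K₀ n).support, w ∈ Q.no) (h₁ : ∀ n : ℕ, ∀ w ∈ (K₁ n).support, w ∈ Q.yes)
    (n : ℕ) (w : List Bool) (hw : w ∈ (mixEnsemble K₀ K₁ n).support) : w ∈ Q.yes ∨ w ∈ Q.no := by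
  rcases (mem_support_mixEnsemble_iff K₀ K₁ n w).1 hw with h | h
  · exact Or.inr (h₀ n w h)
  · exact Or.inl (h₁ n w h)

/-- **Dual-mode pairs give hard samplable ensembles, for every degree `d`.** Two polynomial-time
samplable, computationally indistinguishable ensembles of `PEA d` instances, `K₀` supported on NO
instances and `K₁` on YES instances, yield a polynomial-time samplable ensemble supported on the
promise on which `(PEA d).yes` is not in `HeurBPP`: their fair mixture (`mixEnsemble`; samplable by
`Ensemble.isPolySamplable_mixEnsemble`, hard by `pea_not_mem_HeurBPP_of_dualMode` with the
domination `K_b ≤ 2 · (½ K₀ + ½ K₁)`). [Goldreich2001, Def. 3.2.2; BogdanovTrevisan2006,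
Def. 2.1, 2.12–2.13; DvirGutfreundRothblumVadhan2010, pp. 2–3] -/
theorem exists_hard_samplable_of_dualMode (d : ℕ) {K₀ K₁ : Ensemble}
    (hK₀ : K₀.IsPolySamplable) (hK₁ : K₁.IsPolySamplable)
    (h₀ : ∀ n : ℕ, ∀ w ∈ (K₀ n).support, w ∈ (PEA d).no)
    (h₁ : ∀ n : ℕ, ∀ w ∈ (K₁ n).support, w ∈ (PEA d).yes)
    (hind : IsCompIndistinguishable K₀ K₁) :
    ∃ D : Ensemble, D.IsPolySamplable ∧
      (∀ n : ℕ, ∀ w ∈ (D n).support, w ∈ (PEA d).yes ∨ w ∈ (PEA d).no) ∧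
      (⟨(PEA d).yes, D⟩ : DistProblem) ∉ HeurBPP :=
  ⟨mixEnsemble K₀ K₁, Ensemble.isPolySamplable_mixEnsemble hK₀ hK₁,
    mixEnsemble_support_subset_promise h₀ h₁,
    pea_not_mem_HeurBPP_of_dualMode d h₀ h₁
      (fun n E => by simpa using toOuterMeasure_le_two_mul_mixEnsemble K₀ K₁ n E false)
      (fun n E => by simpa using toOuterMeasure_le_two_mul_mixEnsemble K₀ K₁ n E true) hind⟩

/-- **The infinitely-often version for `PEA d`**: a samplable promise-separated pair that every PPT
distinguisher fails to `9/32`-distinguish at SOME parameter already yields a polynomial-time samplable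
promise-supported ensemble on which `(PEA d).yes ∉ HeurBPP` (their fair mixture).
[DvirGutfreundRothblumVadhan2010, pp. 2–3; Goldreich2001, Def. 3.2.2] -/
theorem exists_hard_samplable_of_io_dualMode (d : ℕ) {K₀ K₁ : Ensemble}
    (hK₀ : K₀.IsPolySamplable) (hK₁ : K₁.IsPolySamplable)
    (h₀ : ∀ n : ℕ, ∀ w ∈ (K₀ n).support, w ∈ (PEA d).no)
    (h₁ : ∀ n : ℕ, ∀ w ∈ (K₁ n).support, w ∈ (PEA d).yes)
    (hio : ∀ B : RandAlg (List Bool) Bool, IsPPT B encodeBool → ∃ n, distAdvantage B K₀ K₁ n < 9 / 32) :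
    ∃ D : Ensemble, D.IsPolySamplable ∧
      (∀ n : ℕ, ∀ w ∈ (D n).support, w ∈ (PEA d).yes ∨ w ∈ (PEA d).no) ∧
      (⟨(PEA d).yes, D⟩ : DistProblem) ∉ HeurBPP :=
  ⟨mixEnsemble K₀ K₁, Ensemble.isPolySamplable_mixEnsemble hK₀ hK₁,
    mixEnsemble_support_subset_promise h₀ h₁,
    not_mem_HeurBPP_of_io_indistinguishable (PEA_disjoint d) h₀ h₁
      (fun n E => by simpa using toOuterMeasure_le_two_mul_mixEnsemble K₀ K₁ n E false)
      (fun n E => by simpa using toOuterMeasure_le_two_mul_mixEnsemble K₀ K₁ n E true) hio⟩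

/-- **Card B, first lemma (`Sketch.conclusion_of_dualMode`), proved** — the statement of the
crux-ideate sketch verbatim (its `Conclusion` unfolded): two polynomial-time samplable ensembles of
`PEA₃` instances, one supported on NO instances and one on YES instances, that are computationally
indistinguishable, give the conclusion of the crux `PeaWorstToAvg`.
[DvirGutfreundRothblumVadhan2010, pp. 2–3; Goldreich2001, Def. 3.2.2] -/
theorem conclusion_of_dualMode (K₀ K₁ : Ensemble)
    (hK₀ : K₀.IsPolySamplable) (hK₁ : K₁.IsPolySamplable)
    (h₀ : ∀ n : ℕ, ∀ w ∈ (K₀ n).support, w ∈ (PEA 3).no)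
    (h₁ : ∀ n : ℕ, ∀ w ∈ (K₁ n).support, w ∈ (PEA 3).yes)
    (hind : IsCompIndistinguishable K₀ K₁) :
    ∃ D : Ensemble, D.IsPolySamplable ∧
      (∀ n : ℕ, ∀ w ∈ (D n).support, w ∈ (PEA 3).yes ∨ w ∈ (PEA 3).no) ∧
      DistProblem.mk (PEA 3).yes D ∉ HeurBPP :=
  exists_hard_samplable_of_dualMode 3 hK₀ hK₁ h₀ h₁ hind

/-- **Card B, transfer shape (`Sketch.peaWorstToAvg_of_dualMode_transfer`), proved.** The crux
`PeaWorstToAvg` (route SzkEntropy, stmt-PneNP-10777) follows from ONE primitive-existence statement: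
worst-case hardness of `PEA₃` for randomized polynomial time yields a computationally
indistinguishable, promise-separated pair of polynomial-time samplable ensembles of cubic-map
instances (a dual-mode / lossy family compiled into `PEA₃`; this hypothesis is the open content of
the card and is NOT claimed). [DvirGutfreundRothblumVadhan2010, pp. 2–3; PeikertWaters2008 (dual-mode
/ lossy families)] -/
theorem peaWorstToAvg_of_dualMode_transfer
    (h : PEA 3 ∉ PromiseBPP' →
      ∃ K₀ K₁ : Ensemble, K₀.IsPolySamplable ∧ K₁.IsPolySamplable ∧
        (∀ n : ℕ, ∀ w ∈ (K₀ n).support, w ∈ (PEA 3).no) ∧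
        (∀ n : ℕ, ∀ w ∈ (K₁ n).support, w ∈ (PEA 3).yes) ∧
        IsCompIndistinguishable K₀ K₁) :
    Summit.PneNP.PneNP.Theses.SzkEntropy.PeaWorstToAvg :=
  szkEntropy_peaWorstToAvg_iff.2 fun hn => by
    obtain ⟨K₀, K₁, hK₀, hK₁, h₀, h₁, hind⟩ := h hn
    exact conclusion_of_dualMode K₀ K₁ hK₀ hK₁ h₀ h₁ hind

/-- **An unconditional dual-mode pair settles the crux** (and, by the converse
`szkEntropy_peaWorstToAvg_converse`, also gives `PEA 3 ∉ PromiseBPP'`): if an indistinguishable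
promise-separated samplable pair of `PEA₃` ensembles simply EXISTS, `PeaWorstToAvg` holds.
[DvirGutfreundRothblumVadhan2010, pp. 2–3] -/
theorem peaWorstToAvg_of_dualModePair
    (h : ∃ K₀ K₁ : Ensemble, K₀.IsPolySamplable ∧ K₁.IsPolySamplable ∧
        (∀ n : ℕ, ∀ w ∈ (K₀ n).support, w ∈ (PEA 3).no) ∧
        (∀ n : ℕ, ∀ w ∈ (K₁ n).support, w ∈ (PEA 3).yes) ∧
        IsCompIndistinguishable K₀ K₁) :
    Summit.PneNP.PneNP.Theses.SzkEntropy.PeaWorstToAvg ∧ PEA 3 ∉ PromiseBPP' := by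
  obtain ⟨K₀, K₁, hK₀, hK₁, h₀, h₁, hind⟩ := h
  have hc := conclusion_of_dualMode K₀ K₁ hK₀ hK₁ h₀ h₁ hind
  exact ⟨szkEntropy_peaWorstToAvg_iff.2 fun _ => hc, szkEntropy_peaWorstToAvg_converse hc⟩

/-- **Transfer shape, infinitely-often form.** `PeaWorstToAvg` already follows if worst-case
hardness of `PEA₃` yields a samplable promise-separated pair of cubic-map ensembles that every PPT
distinguisher fails to `9/32`-distinguish at some parameter — a weaker primitive than a dual-mode
family (the quantifier shape `∀ distinguisher ∃ n` is that of worst-case hardness itself).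
[DvirGutfreundRothblumVadhan2010, pp. 2–3] -/
theorem peaWorstToAvg_of_io_dualMode_transfer
    (h : PEA 3 ∉ PromiseBPP' →
      ∃ K₀ K₁ : Ensemble, K₀.IsPolySamplable ∧ K₁.IsPolySamplable ∧
        (∀ n : ℕ, ∀ w ∈ (K₀ n).support, w ∈ (PEA 3).no) ∧
        (∀ n : ℕ, ∀ w ∈ (K₁ n).support, w ∈ (PEA 3).yes) ∧
        ∀ B : RandAlg (List Bool) Bool, IsPPT B encodeBool → ∃ n, distAdvantage B K₀ K₁ n < 9 / 32) :
    Summit.PneNP.PneNP.Theses.SzkEntropy.PeaWorstToAvg :=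
  szkEntropy_peaWorstToAvg_iff.2 fun hn => by
    obtain ⟨K₀, K₁, hK₀, hK₁, h₀, h₁, hio⟩ := h hn
    exact exists_hard_samplable_of_io_dualMode 3 hK₀ hK₁ h₀ h₁ hio

end Summit.PneNP.PneNP.Theorems
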